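import Summits.BirchSwinnertonDyer.BirchSwinnertonDyer.Theorems.ErratumRoadFiveShimuraKolyvaginOrderBoundInertMachineEntry
import Summits.BirchSwinnertonDyer.Rank1Residual.X11b.KolyvaginReciprocityFinsetOfPoitouTate
import HarnessLib

/-!
# Kolyvagin's ORDER bound for Heegner-type Euler systems, keyed on the CONDUCTOR — part 2: Kolyvagin
# reciprocity against Selmer classes vanishing on a finite set of places, from Poitou–Tate

Cell `bsd-stepL` (run/shared/lean/pub/bsd-stepL/), seat `bsd-stepL-shim3a` (prover g2), HELPER for the crux
`Summit.BirchSwinnertonDyer.BirchSwinnertonDyer.Theses.ClassRecordThree.ShimuraKolyvaginOrderBoundAtThreeSurj`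
(item stmt-BirchSwinnertonDyer-19899; `--supports … --as helper`); serves S2 of item 19718 and item 19627 too.
Road memo HOME/shim/SHIM3A-G2-ROAD-19899.md §2 (ε₃). Companion of `…SurjOrderCTValue.lean` (part 1).

## What

The ORDER machine's reciprocity input `hRT` (Kolyvagin reciprocity (R)_M at a Kolyvagin prime against Selmer
classes vanishing on a finite set `T`, McCallum 1991 Prop. 2.2 + Gross 1991 (7.6)) is derived by x11b3 from the
Poitou–Tate named fact in `X11b/KolyvaginReciprocityFinsetOfPoitouTate.lean`, and turned into the descent's
duality leaves (B) ∕ (B₂) in `…PrimaryAnnihilatorLeavesProofs.lean` — all keyed on `hP : IsHeegnerPoint N W K P`,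
used ONCE each, for good reduction at `λ`. This file gives the conductor-keyed twins (statements = the tree's
with `hP` replaced by `hN : W.conductorNorm ℤ = N`, the idle binders of the reciprocity theorem dropped as in
shim-p1's `kolyvaginReciprocityM_of_poitouTate_of_conductorNorm`; proofs = the tree's, token for token, with
shim-p1's `hasGoodReductionAt_place_of_isKolyvaginPrime_of_conductorNorm` at the one place `hP` was used):

* `kolyvaginReciprocityFinset_of_poitouTate_of_conductorNorm` (x11b3-p2's proof, adapted); the duality
  leaves (B) ∕ (B₂) follow in the sibling `…SurjOrderLeaves.lean`.

## Honest framing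

THEOREMS ONLY (no `def`, no named fact, no `sorry`; axioms standard). CONDITIONAL on the cite-only named fact
`poitouTate_sum_localTatePairing_eq_zero` where it is a hypothesis. Nothing here constructs an Euler system;
item 19899 stays OPEN. BSD is not proved by any of this.

## References

[cite: McCallumLMS1991, §2 Prop. 2.2, §5 Lemma 5.3 and proof of Prop. 5.2]
[cite: GrossLMS1991, §7 (7.1), (7.6), Prop. 8.1 (2), Prop. 8.2, §9]
[cite: MilneADT2006, Ch. I Thm. 4.10(b), Cor. 2.3, Prop. 3.8] [cite: NeukirchANT1999, Ch. II §9 Prop. (9.6)]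
presearch: not applicable (re-keying of tree theorems). Tree: `lean search 'ReciprocityFinset_of_poitouTate_of_conductorNorm'` → none.
-/

noncomputable section

open scoped Classical Pointwise
set_option linter.dupNamespace false
namespace Summit.BirchSwinnertonDyer.BirchSwinnertonDyer.Theorems.ShimuraKolyvaginOrder

open WeierstrassCurve NumberField IsDedekindDomain Field Function ValuativeRel
  Literature.NumberTheory.EllipticCurves Literature.NumberTheory.EllipticCurves.KolyvaginCocycle
  Literature.NumberTheory.EllipticCurves.KolyvaginDescent
  Literature.NumberTheory.EllipticCurves.RingClassField
  Literature.NumberTheory.GaloisRepresentations Literature.NumberTheory.NumberFields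
  Literature.NumberTheory.GaloisRepresentations.IsNonarchimedeanLocalField
  Literature.NumberTheory.GaloisCohomology
  Summit.BirchSwinnertonDyer.Rank1Residual Summit.BirchSwinnertonDyer.Rank1Residual.X11b
  Summit.BirchSwinnertonDyer.Rank1Residual.X11b.KolyvaginReciprocity
  Summit.BirchSwinnertonDyer.BirchSwinnertonDyer.Theorems
open Literature.NumberTheory.GaloisRepresentations.DiscreteGaloisModule (mu MuCarrier)

variable {K : Type} [Field K] [NumberField K]

/-! ### §1 (R)_M against Selmer classes vanishing on a finite set of places, from (PT), conductor-keyed -/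

/-- **Kolyvagin reciprocity (R)_M at a Kolyvagin prime against Selmer classes vanishing on a finite set `T`
of further places, from Poitou–Tate — conductor-keyed twin of x11b3's
`KolyvaginReciprocity.kolyvaginReciprocityFinset_of_poitouTate`.** For `E = W/ℚ` elliptic of conductor `N`,
a number field `K`, a prime `p`, `M ≥ 1` and a Kolyvagin prime `ℓ` of level `N`: CONDITIONAL on
`hPT : poitouTate_sum_localTatePairing_eq_zero K` (cite-only named fact), the Weil pairing `e` on `E[p^M]`
has `e([s, F], [c', σ]) = 0` for every finite set `T` of finite places, every `s ∈ Sel_{p^M}(E/K)` with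
`loc_v s = 0` for `v ∈ T`, every `c'` Selmer at the finite places outside `T ∪ {λ}` and at infinity, every
`𝔔 ∣ λ`, Frobenius `F` at `𝔔` fixing `E[p^M]` and `σ ∈ I_𝔔`. SAME proof as x11b3's EXCEPT that
`IsHeegnerPoint N W K P` — used there once, for good reduction at `λ` — is replaced by `W.conductorNorm ℤ = N`;
the idle binders of the original (`¬ HasCM`, `IsImaginaryQuadratic`, `d_K ∉ {-3,-4}`, Heegner hypothesis,
the point, `p ≠ 2`, `ρ̄` onto, `Frob(ℓ) = Frob(∞)`) are dropped. Output shape = the `hRT` binder of x11b3's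
ORDER machine at the level `M`. [cite: McCallumLMS1991, §2 Prop. 2.2, §5 Lemma 5.3 and proof of Prop. 5.2]
[cite: GrossLMS1991, §7 (7.1), (7.6), Prop. 8.1 (2), Prop. 8.2, §9]
[cite: MilneADT2006, Ch. I Thm. 4.10(b), Cor. 2.3, Prop. 3.8] [cite: NeukirchANT1999, Ch. II §9 Prop. (9.6)] -/
theorem kolyvaginReciprocityFinset_of_poitouTate_of_conductorNorm {N : ℕ} [NeZero N]
    (W : WeierstrassCurve ℚ) [W.IsElliptic] (hN : W.conductorNorm ℤ = N)
    (hPT : poitouTate_sum_localTatePairing_eq_zero K) {p : ℕ} (hp : p.Prime) {M : ℕ} (hM : 1 ≤ M)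
    {ℓ : ℕ} (hℓ : IsKolyvaginPrime N W K p ℓ) :
      ∃ (A : Type) (_ : AddCommGroup A)
        (e : geomTorsion (W.baseChange K) ((p ^ M : ℕ) : ℤ) →+
          geomTorsion (W.baseChange K) ((p ^ M : ℕ) : ℤ) →+ A),
        (∀ x, e x x = 0) ∧ (∀ x, (∀ y, e x y = 0) → x = 0) ∧
        ∀ (T : Finset (HeightOneSpectrum (𝓞 K))),
        ∀ s ∈ selmerGroup (W.baseChange K) ((p ^ M : ℕ) : ℤ),
          (∀ v ∈ T, s ∈ (W.baseChange K).torsionLocalKer (v.adicCompletion K) ((p ^ M : ℕ) : ℤ)) →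
          ∀ c' : galH1Torsion (W.baseChange K) ((p ^ M : ℕ) : ℤ),
          (∀ v : HeightOneSpectrum (𝓞 K), v ∉ T → (ℓ : 𝓞 K) ∉ v.asIdeal →
            c' ∈ selmerLocalKer (W.baseChange K) (v.adicCompletion K) ((p ^ M : ℕ) : ℤ)) →
          (∀ w : InfinitePlace K,
            c' ∈ selmerLocalKer (W.baseChange K) w.Completion ((p ^ M : ℕ) : ℤ)) →
          ∀ 𝔔 ∈ hℓ.place.primesAbove, ∀ F : Field.absoluteGaloisGroup K,
            IsArithFrobAt (𝓞 K) F 𝔔 →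
            F ∈ torsionFixing (W.baseChange K) ((p ^ M : ℕ) : ℤ) →
            ∀ σ ∈ 𝔔.inertia (Field.absoluteGaloisGroup K),
            e (h1Eval (W.baseChange K) ((p ^ M : ℕ) : ℤ) s F)
              (h1Eval (W.baseChange K) ((p ^ M : ℕ) : ℤ) c' σ) = 0 := by
  -- compactness of absolute Galois groups (cup products), as a local hypothesis
  have _hΓc : ∀ (L : Type) [Field L], CompactSpace (absoluteGaloisGroup L) :=
    fun L _ => absoluteGaloisGroup_compactSpace L
  haveI : NeZero (p ^ M) := ⟨pow_ne_zero _ hp.ne_zero⟩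
  haveI : (W.baseChange K).IsElliptic := inferInstanceAs (W.map (algebraMap ℚ K)).IsElliptic
  have hq2 : 2 ≤ p ^ M := le_trans hp.two_le (Nat.le_self_pow (by omega) p)
  have hqK : ((p ^ M : ℕ) : K) ≠ 0 := Nat.cast_ne_zero.mpr (NeZero.ne (p ^ M))
  have hp0 : ((p ^ M : ℕ) : ℤ) ≠ 0 := by exact_mod_cast NeZero.ne (p ^ M)
  -- the Weil pairing on `E[p^M]` over `K`
  obtain ⟨e, hμ, hadd₁, hadd₂, halt, hnondeg, hgal⟩ :=
    (W.baseChange K).exists_weilPairing_holds (p ^ M) hq2 hqK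
  refine ⟨MuCarrier K (p ^ M), inferInstance,
    weilPairingHom (W.baseChange K) (p ^ M) e hμ hadd₁ hadd₂,
    weilPairingHom_self (W.baseChange K) (p ^ M) e hμ hadd₁ hadd₂ halt,
    TameCup.weilPairingHom_left_nondeg (W.baseChange K) (p ^ M) e hμ hadd₁ hadd₂ halt hnondeg, ?_⟩
  intro T s hs hsT c' hc'fin hc'inf 𝔔 h𝔔 F hF hFfix σ hσ
  -- ### the family of local invariant maps of the Poitou–Tate fact at level `p^M`
  obtain ⟨inv, hperf, hsum⟩ := hPT (p ^ M)
  set lam := hℓ.place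
  -- ### the finite set of places `S = {λ} ∪ T`
  set S : Finset (Place K) :=
    insert (Sum.inr lam) (T.map ⟨Sum.inr, Sum.inr_injective⟩) with hSdef
  have hmemS : Sum.inr lam ∈ S := Finset.mem_insert_self _ _
  -- ### local terms vanish off `S`: both classes satisfy the Kummer condition there (isotropy)
  have hsS : s ∈ ((W.baseChange K).kummerSelmerStructure ((p ^ M : ℕ) : ℤ)).selmerGroup := by
    rw [← selmerGroup_eq_selmerGroup_kummerSelmerStructure]; exact hs
  have hloc_s : ∀ v : Place K, galoisCohomology.localization ((W.baseChange K).torsionGaloisModule ((p ^ M : ℕ) : ℤ)) v 1 s ∈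
      (W.baseChange K).kummerSelmerStructure ((p ^ M : ℕ) : ℤ) v :=
    ((((W.baseChange K).kummerSelmerStructure ((p ^ M : ℕ) : ℤ)).mem_selmerGroup_iff s).mp hsS)
  have hloc_c' : ∀ v : Place K, v ∉ S →
      galoisCohomology.localization ((W.baseChange K).torsionGaloisModule ((p ^ M : ℕ) : ℤ)) v 1 c' ∈
        (W.baseChange K).kummerSelmerStructure ((p ^ M : ℕ) : ℤ) v := by
    intro v hv
    have hmem : c' ∈ selmerLocalKer (W.baseChange K) (Place.Completion v) ((p ^ M : ℕ) : ℤ) := by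
      rcases v with w | v
      · exact hc'inf w
      · refine hc'fin v (fun hT => hv ?_) (fun h => hv ?_)
        · exact Finset.mem_insert_of_mem (Finset.mem_map.mpr ⟨v, hT, rfl⟩)
        · rw [hℓ.mem_iff.mp h]
          exact hmemS
    rw [← (W.baseChange K).comap_localization_kummerSelmerStructure ((p ^ M : ℕ) : ℤ) v] at hmem
    exact hmem
  have hS : ∀ v ∉ S,
      inv v ((weilContPairingLocal (W.baseChange K) (p ^ M) e hμ hadd₁ hadd₂ hgal v).cupProduct
        (galoisCohomology.localization ((W.baseChange K).torsionGaloisModule ((p ^ M : ℕ) : ℤ)) v 1 s)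
        (galoisCohomology.localization ((W.baseChange K).torsionGaloisModule ((p ^ M : ℕ) : ℤ)) v 1 c')) = 0 := by
    intro v hv
    have h0 := (W.baseChange K).cupProduct_eq_zero_of_mem_kummerSelmerStructure_of_fact (p ^ M) e
      (by exact_mod_cast NeZero.ne (p ^ M)) v (kummerClass_cupProduct_kummerClass_eq_zero_holds (Place.Completion v))
      hμ hadd₁ hadd₂ halt hgal (hloc_s v) (hloc_c' v hv)
    exact (congrArg (inv v) h0).trans (map_zero _)
  -- ### the terms at `v ∈ T`, `v ≠ λ` vanish: `loc_v s = 0`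
  have hT : ∀ v ∈ S, v ≠ Sum.inr lam →
      inv v ((weilContPairingLocal (W.baseChange K) (p ^ M) e hμ hadd₁ hadd₂ hgal v).cupProduct
        (galoisCohomology.localization ((W.baseChange K).torsionGaloisModule ((p ^ M : ℕ) : ℤ)) v 1 s)
        (galoisCohomology.localization ((W.baseChange K).torsionGaloisModule ((p ^ M : ℕ) : ℤ)) v 1 c')) = 0 := by
    intro v hv hne
    rcases Finset.mem_insert.mp hv with h | h
    · exact absurd h hne
    · obtain ⟨v', hv'T, rfl⟩ := Finset.mem_map.mp h
      have h0 : galoisCohomology.localization ((W.baseChange K).torsionGaloisModule ((p ^ M : ℕ) : ℤ))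
          (Sum.inr v') 1 s = 0 :=
        localization_eq_zero_of_mem_torsionLocalKer (W.baseChange K) hp0 v' (hsT v' hv'T)
      have hcup0 : (weilContPairingLocal (W.baseChange K) (p ^ M) e hμ hadd₁ hadd₂ hgal
          (Sum.inr v')).cupProduct
        (galoisCohomology.localization ((W.baseChange K).torsionGaloisModule ((p ^ M : ℕ) : ℤ))
          (Sum.inr v') 1 s)
        (galoisCohomology.localization ((W.baseChange K).torsionGaloisModule ((p ^ M : ℕ) : ℤ))
          (Sum.inr v') 1 c') = 0 := by
        have hz : (weilContPairingLocal (W.baseChange K) (p ^ M) e hμ hadd₁ hadd₂ hgal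
            (Sum.inr v')).cupProduct
            (0 : galoisCohomology (((W.baseChange K).torsionGaloisModule ((p ^ M : ℕ) : ℤ)).toLocal
              (Sum.inr v')) 1) = 0 :=
          map_zero _
        rw [h0, hz, LinearMap.zero_apply]
      exact (congrArg (inv (Sum.inr v')) hcup0).trans (map_zero _)
  -- ### Poitou–Tate: the local term at `λ` vanishes too, hence the local cup product is zero
  have hPTsum := sum_inv_weilCupProduct_localization_eq_zero (W.baseChange K) (p ^ M) e hμ hadd₁ hadd₂ hgal
    inv hsum s c' S hS
  rw [Finset.sum_eq_single_of_mem (Sum.inr lam) hmemS hT] at hPTsum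
  have hcup : ((weilContPairing (W.baseChange K) (p ^ M) e hμ hadd₁ hadd₂ hgal).restrict
      (absGaloisRestrict K (lam.adicCompletion K))).cupProduct
        (galoisCohomology.localization ((W.baseChange K).torsionGaloisModule ((p ^ M : ℕ) : ℤ)) (Sum.inr lam) 1 s)
        (galoisCohomology.localization ((W.baseChange K).torsionGaloisModule ((p ^ M : ℕ) : ℤ)) (Sum.inr lam) 1 c') = 0 :=
    (hperf lam).1.injective (hPTsum.trans (map_zero _).symm)
  -- ### the local step (FILE 1b of the sibling) at `K_λ`: bridge `Γ_K`-decomposition data ↔ `Γ_{K_λ}`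
  haveI : Fact p.Prime := ⟨hp⟩
  haveI : CharZero (lam.adicCompletion K) :=
    charZero_of_injective_algebraMap (algebraMap K (lam.adicCompletion K)).injective
  -- good reduction at `λ`, `p ∉ λ`, `p ^ M ∉ λ`
  have hgood : (W.baseChange K).HasGoodReductionAt lam :=
    hasGoodReductionAt_place_of_isKolyvaginPrime_of_conductorNorm W hN hℓ
  have hpv : ((p : ℕ) : 𝓞 K) ∉ lam.asIdeal :=
    not_natCast_mem_of_prime_ne hℓ.prime hp hℓ.2.2.2.1 lam hℓ.mem_place
  have hqv : ((((p ^ M : ℕ) : ℤ)) : 𝓞 K) ∉ lam.asIdeal := by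
    rw [Int.cast_natCast, Nat.cast_pow]
    exact fun h => hpv (lam.isPrime.mem_of_pow_mem M h)
  -- the prime `𝔓₀ ∣ λ` cut out by `K̄ → \bar K_λ`; `g • 𝔔 = 𝔓₀` (transitivity of `Γ_K`)
  have h𝔓₀ : adicCompletionPrime K lam ∈ lam.primesAbove := adicCompletionPrime_mem_primesAbove K lam
  obtain ⟨g, hg⟩ := HeightOneSpectrum.exists_smul_eq_of_mem_primesAbove_holds h𝔔 h𝔓₀
  have hDeq := decompositionSubgroup_adicCompletionPrime_eq_range K lam
  have hIeq := inertia_adicCompletionPrime_eq_map_absInertia K lam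
  -- `F₀ = g F g⁻¹` is a Frobenius at `𝔓₀` fixing `E[p^M]`; `σ₀ = g σ g⁻¹ ∈ I_{𝔓₀}`
  have hF₀ : IsArithFrobAt (𝓞 K) (g * F * g⁻¹) (adicCompletionPrime K lam) := by
    have h := hF.conj g
    rwa [hg] at h
  have hF₀fix : g * F * g⁻¹ ∈ torsionFixing (W.baseChange K) ((p ^ M : ℕ) : ℤ) :=
    (torsionFixing_normal (W.baseChange K) _).conj_mem F hFfix g
  have hσ₀ : g * σ * g⁻¹ ∈ (adicCompletionPrime K lam).inertia (absoluteGaloisGroup K) := by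
    rw [← hg]
    intro x
    have hx := Ideal.smul_mem_pointwise_smul g _ 𝔔 (hσ (g⁻¹ • x))
    rwa [smul_sub, smul_inv_smul, ← mul_smul, ← mul_smul] at hx
  -- inertia at `𝔓₀` fixes `E[p^M]` (good reduction, `λ ∤ p`)
  have hI₀ : (adicCompletionPrime K lam).inertia (absoluteGaloisGroup K) ≤
      torsionFixing (W.baseChange K) ((p ^ M : ℕ) : ℤ) := fun τ hτ =>
    (mem_torsionFixing_iff _ _).mpr fun Q =>
      (W.baseChange K).smul_geomTorsion_eq_of_mem_inertia hgood hqv h𝔓₀ hτ Q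
  have hσ₀fix : g * σ * g⁻¹ ∈ torsionFixing (W.baseChange K) ((p ^ M : ℕ) : ℤ) := hI₀ hσ₀
  -- `F₀ = res gF`, `σ₀ = res t` with `t ∈ I_{K_λ}` (`D_{𝔓₀} = res Γ_{K_λ}`, `I_{𝔓₀} = res I_{K_λ}`)
  obtain ⟨gF, hgF⟩ : ∃ gF : absoluteGaloisGroup (lam.adicCompletion K),
      absGaloisRestrict K (lam.adicCompletion K) gF = g * F * g⁻¹ := by
    have hmem : g * F * g⁻¹ ∈
        (adicCompletionPrime K lam).decompositionSubgroup (absoluteGaloisGroup K) :=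
      hF₀.mem_stabilizer
    rw [hDeq] at hmem
    obtain ⟨gF, hgF⟩ := hmem
    exact ⟨gF, hgF⟩
  obtain ⟨t, ht, hgt⟩ : ∃ t ∈ absInertia (lam.adicCompletion K),
      absGaloisRestrict K (lam.adicCompletion K) t = g * σ * g⁻¹ := by
    have hmem := hσ₀
    rw [hIeq] at hmem
    obtain ⟨t, ht, hgt⟩ := hmem
    exact ⟨t, ht, hgt⟩
  -- `Γ_{K_λ}` acts trivially on `E[p^M]`: `D_{𝔓₀} = ⟨F₀⟩ · I_{𝔓₀} · Γ_{K(E[p^M])}`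
  have htriv : ∀ (g' : absoluteGaloisGroup (lam.adicCompletion K))
      (Q : geomTorsion (W.baseChange K) ((p ^ M : ℕ) : ℤ)),
      absGaloisRestrict K (lam.adicCompletion K) g' • Q = Q := by
    intro g' Q
    have hd : absGaloisRestrict K (lam.adicCompletion K) g' ∈
        (adicCompletionPrime K lam).decompositionSubgroup (absoluteGaloisGroup K) := by
      rw [hDeq]; exact ⟨g', rfl⟩
    obtain ⟨k, i, u, hi, hu, hdeq⟩ := exists_eq_frobenius_pow_mul_of_mem_decompositionSubgroup
      h𝔓₀ hF₀ (isOpen_torsionFixing (W.baseChange K) hp0) hd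
    have hmem : absGaloisRestrict K (lam.adicCompletion K) g' ∈
        torsionFixing (W.baseChange K) ((p ^ M : ℕ) : ℤ) := by
      rw [hdeq]
      exact Subgroup.mul_mem _ (Subgroup.mul_mem _ (Subgroup.pow_mem _ hF₀fix k) (hI₀ hi)) hu
    exact smul_eq_of_mem_torsionFixing _ _ hmem Q
  -- the residue characteristic of `K_λ` is prime to `p ^ M` (`λ ∤ p`)
  have hn : ¬ ringChar 𝓀[lam.adicCompletion K] ∣ p ^ M := fun h =>
    GaloisImage.ringChar_residueField_adicCompletion_ne_of_not_mem lam p hpv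
      ((Nat.prime_dvd_prime_iff_eq (ringChar_residueField_prime (F := lam.adicCompletion K)) hp).mp
        ((ringChar_residueField_prime (F := lam.adicCompletion K)).dvd_of_dvd_pow h)).symm
  -- a frame `E[p^M] ≃ (ℤ/p^M)²`
  obtain ⟨ε₀⟩ := nonempty_addEquiv_geomTorsion (W.baseChange K) p M hM
    (Nat.cast_ne_zero.mpr hp.ne_zero)
  let ε : geomTorsion (W.baseChange K) ((p ^ M : ℕ) : ℤ) ≃+ ZMod (p ^ M) × ZMod (p ^ M) :=
    ε₀.trans (LinearEquiv.finTwoArrow ℤ (ZMod (p ^ M))).toAddEquiv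
  -- the injective local invariant map at `λ`
  have hinv : Function.Injective (inv (Sum.inr lam)) := (hperf lam).1.injective
  -- the local cocycles: restrictions to `Γ_{K_λ}` of the chosen cocycles of `s` and `c'`
  let φ : contOneCocycles (DiscreteGaloisModule.toTopRep (GaloisRep.restrictField
      (lam.adicCompletion K) ((W.baseChange K).torsionGaloisModule ((p ^ M : ℕ) : ℤ)))) :=
    contOneCocycles.pullback (absGaloisRestrict K (lam.adicCompletion K))
      (X := discreteTopRep (absoluteGaloisGroup K) (geomTorsion (W.baseChange K) ((p ^ M : ℕ) : ℤ)))
      (Y := DiscreteGaloisModule.toTopRep (GaloisRep.restrictField (lam.adicCompletion K)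
        ((W.baseChange K).torsionGaloisModule ((p ^ M : ℕ) : ℤ))))
      (TopRep.ofHom ⟨ContinuousLinearMap.id ℤ _, fun _ => rfl⟩)
      (reprCocycle (W.baseChange K) ((p ^ M : ℕ) : ℤ) s)
  let ψ : contOneCocycles (DiscreteGaloisModule.toTopRep (GaloisRep.restrictField
      (lam.adicCompletion K) ((W.baseChange K).torsionGaloisModule ((p ^ M : ℕ) : ℤ)))) :=
    contOneCocycles.pullback (absGaloisRestrict K (lam.adicCompletion K))
      (X := discreteTopRep (absoluteGaloisGroup K) (geomTorsion (W.baseChange K) ((p ^ M : ℕ) : ℤ)))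
      (Y := DiscreteGaloisModule.toTopRep (GaloisRep.restrictField (lam.adicCompletion K)
        ((W.baseChange K).torsionGaloisModule ((p ^ M : ℕ) : ℤ))))
      (TopRep.ofHom ⟨ContinuousLinearMap.id ℤ _, fun _ => rfl⟩)
      (reprCocycle (W.baseChange K) ((p ^ M : ℕ) : ℤ) c')
  have hφcl : galoisCohomology.localization ((W.baseChange K).torsionGaloisModule ((p ^ M : ℕ) : ℤ))
      (Sum.inr lam) 1 s = oneCocycleClass _ φ := by
    have h := (W.baseChange K).res_torsionGaloisModule_oneCocycleClass ((p ^ M : ℕ) : ℤ)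
      (lam.adicCompletion K) (reprCocycle (W.baseChange K) ((p ^ M : ℕ) : ℤ) s)
    rw [oneCocycleClass_reprCocycle] at h
    exact h
  have hψcl : galoisCohomology.localization ((W.baseChange K).torsionGaloisModule ((p ^ M : ℕ) : ℤ))
      (Sum.inr lam) 1 c' = oneCocycleClass _ ψ := by
    have h := (W.baseChange K).res_torsionGaloisModule_oneCocycleClass ((p ^ M : ℕ) : ℤ)
      (lam.adicCompletion K) (reprCocycle (W.baseChange K) ((p ^ M : ℕ) : ℤ) c')
    rw [oneCocycleClass_reprCocycle] at h
    exact h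
  rw [hφcl, hψcl] at hcup
  -- `φ` vanishes on `I_{K_λ}`: `s` is Selmer at the good place `λ ∤ p^M` (Gross (7.1))
  have hsel : s ∈ selmerLocalKer (W.baseChange K) (lam.adicCompletion K) ((p ^ M : ℕ) : ℤ) :=
    ((mem_selmerGroup_iff (W.baseChange K) _ s).mp hs).1 lam
  have hsI : ∀ τ ∈ (adicCompletionPrime K lam).inertia (absoluteGaloisGroup K),
      (reprCocycle (W.baseChange K) ((p ^ M : ℕ) : ℤ) s).1 τ = 0 := by
    have h := hsel
    rw [← oneCocycleClass_reprCocycle (W.baseChange K) ((p ^ M : ℕ) : ℤ) s] at h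
    exact ((W.baseChange K).oneCocycleClass_mem_selmerLocalKer_iff hgood hqv h𝔓₀ _).mp h
  have hφ : ∀ t' ∈ absInertia (lam.adicCompletion K), φ.1 t' = 0 := by
    intro t' ht'
    have hmem : absGaloisRestrict K (lam.adicCompletion K) t' ∈
        (adicCompletionPrime K lam).inertia (absoluteGaloisGroup K) := by
      rw [hIeq]; exact ⟨t', ht', rfl⟩
    have h0 : (reprCocycle (W.baseChange K) ((p ^ M : ℕ) : ℤ) s).1
        (absGaloisRestrict K (lam.adicCompletion K) t') = 0 := hsI _ hmem
    rw [contOneCocycles.pullback_apply, h0, map_zero]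
  -- the sibling's FILE 1b at `K_λ`: `e([s, F₀], [c', σ₀]) = 1`
  have hloc := TameCup.weilPairing_apply_eq_one_of_cupProduct_eq_zero (W.baseChange K) (p ^ M)
    e hμ hadd₁ hadd₂ (lam.adicCompletion K) halt hnondeg hgal ε hn htriv (inv (Sum.inr lam)) hinv
    φ ψ hφ hcup gF t ht
  rw [contOneCocycles.pullback_apply, contOneCocycles.pullback_apply, hgF, hgt] at hloc
  change e (h1Eval (W.baseChange K) ((p ^ M : ℕ) : ℤ) s (g * F * g⁻¹))
    (h1Eval (W.baseChange K) ((p ^ M : ℕ) : ℤ) c' (g * σ * g⁻¹)) = 1 at hloc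
  -- transport along `g`: `[s, F] = g⁻¹ • [s, F₀]`, `[c', σ] = g⁻¹ • [c', σ₀]`, `e` equivariant
  have hconjF : g⁻¹ * (g * F * g⁻¹) * g⁻¹⁻¹ = F := by group
  have hconjσ : g⁻¹ * (g * σ * g⁻¹) * g⁻¹⁻¹ = σ := by group
  have h1 : h1Eval (W.baseChange K) ((p ^ M : ℕ) : ℤ) s F =
      g⁻¹ • h1Eval (W.baseChange K) ((p ^ M : ℕ) : ℤ) s (g * F * g⁻¹) := by
    rw [← h1Eval_conj (W.baseChange K) _ s g⁻¹ hF₀fix, hconjF]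
  have h2 : h1Eval (W.baseChange K) ((p ^ M : ℕ) : ℤ) c' σ =
      g⁻¹ • h1Eval (W.baseChange K) ((p ^ M : ℕ) : ℤ) c' (g * σ * g⁻¹) := by
    rw [← h1Eval_conj (W.baseChange K) _ c' g⁻¹ hσ₀fix, hconjσ]
  rw [TameCup.weilPairingHom_eq_zero_iff, h1, h2, ← hgal, hloc, smul_one]



end Summit.BirchSwinnertonDyer.BirchSwinnertonDyer.Theorems.ShimuraKolyvaginOrder
end
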